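import Summits.QuantumFields.YangMills.Theorems.UnitScaleTiltProp7GreenKernelSiteTransport
import HarnessLib

/-!
# Route `UnitScaleTilt`, crux K1 «MinimiserStabilityRegPr» (stmt-QuantumFields-19200), route-R E′ path (α′), residue (hK), row (R5) part 3: (A0)₂ THE DICTIONARY `Δ₁⁻² = ¼·G̃₂`
# between B5's squared inverse Laplacian and the biharmonic torus Green function `G̃₂` (in the displayed currency of ✓ `Prop7TorusGreen2HeatKernel`∕✓ `Prop7TorusGreen2HessianDecay`),
# and (R5c) THE FREE KERNEL `Gf` ITSELF in `Site P 0` letters: `Gf x z = (4c⁴)⁻¹(G̃₂(EK z − EK x) − G̃₂(EK z − EK y_c))`,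
# so that (R2) `|∇G̃₂| ≤ C_V` and (R3a) `|∇∇G̃₂|·dist ≤ C_H` read directly on the bond difference `V := Gf b₊ − Gf b₋` (rows: ✓ `Prop7GreenKernelSiteRows` §5)

Cell `ym3-torus`, width seat `ym3-torus-px4` (gen 2); ★ym-routeR-w3 g5 19:28:35Z (R5), standing PASS 19:41:59Z; row (R5c) of px22 g2's (A3) LOCATE v1.2 §5∕§8 («px4 part 3»); the sibling row
(I-site) is px22's ✓ `Prop7PinnedGreenSymmetry.exists_green_site_split_symm` (by reciprocity) — only its two `τ`-side letters are kept here (§1).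
THEOREMS ONLY (0 `def`, 0 `sorry`); `--supports stmt-QuantumFields-19200`, count-neutral.  YM₃ on T³ is a ladder rung (R3), not the Clay problem; nothing here claims the stub, the crux, d = 4 or
the gap.

WHAT IS PROVED (ns `…Theorems.Prop7GreenKernelSiteFree`).
* §1 letters: `LapS_LapS_one_eq_zero_of_natCast` (`Δ_n²u(t) = 0 ⇒ Δ₁²u(t) = 0`), ★ `laplace_laplace_re_comp_tau` (`laplace c (laplace c (Re∘F∘τ)) z = c⁴·Re((Δ₁²F)(τ z))`).
* §2 (A0)₂: `sandwich_apply_const` (`(U*·diag a·U)(x,z) = L^{−d}Σ_p a(p)χ_p(x−z)`), `LapSinv_one_sq_apply`, ★★ `LapSinv_one_sq_apply_eq_quarter_green2` —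
  `(LapSinv (fun _ ↦ L) 1 * LapSinv (fun _ ↦ L) 1) x z = ((Σ_{k≠0} cos(p_k·(x−z))∕ε_k²)∕L^d∕4 : ℝ)`.
* §3 (R5c-formula): ★★★ `exists_green_site_split_free` — ✓ `exists_green_site_split` VERBATIM plus the conjunct `∀ G₂, (∀ t, G₂ t = (Σ_{k≠0}cos(p_k·t)∕ε_k²)∕L_T^{P.d}) → ∀ x z,
  Gf x z = (4c⁴)⁻¹·(G₂(EK z − EK x) − G₂(EK z − EK (embIter k default)))` (`L_T = L^k·sitesPerDir k`).
* (R5c-rows) — the bond-difference rows for ANY `Gf` with that formula (`|Gf b₊ z − Gf b₋ z| ≤ C_V∕(4c⁴)` from (R2), `|∇_z(Gf b₊ − Gf b₋)|·dist ≤ C_H∕(4c⁴)` from (R3a)) are §5 of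
  ✓ `Prop7GreenKernelSiteRows` (v1.2), stated in the same displayed `G₂`∕`hGf` currency.
HONEST SCOPE.  Bookkeeping between two typings of one torus; the analysis is ✓p661993 (the `G̃₂` representation) and, downstream, (R2)∕(R3a).

References: T. Bałaban, CMP 95 (1984) 17–40 [Balaban1984PropagatorsI] (Sect. C p.22, (1.17)–(1.21) pp.20–21); CMP 99 (1985) 75–102 [Balaban1985RegularSpaces] ((1.14) p.78, (1.36) p.82);
G. F. Lawler, V. Limic, *Random Walk: A Modern Introduction*, CUP 2010, Ch. 4 [LawlerLimic2010].
-/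

set_option autoImplicit false

noncomputable section

open scoped BigOperators Matrix ComplexConjugate Real
open Finset Complex Matrix

namespace Summit.QuantumFields.YangMills.Theorems.Prop7GreenKernelSiteFree

open Literature.MathematicalPhysics.QuantumFieldTheory.Balaban1983to89
open LatticeFieldCalculus
open B15DeterminingSets (embIter)
open B5Prop11Plancherel B5Block118 B5LaplaceInverse B5Momentum130 B5Momentum133
open B5Action121 (LapS LapS_mulVec)
open B5Eq117TorusCarriers (Mk EK EK_apply)
open Literature.Probability.LatticeModels
open Prop7GreenKernelSiteTransport
open Prop7TorusGreenDictionary (linv_one_eq chi_neg_left' dispersion_latticeMomentum_neg chi_const_eq_torusChar LapSinv_one_apply_eq_half_torusGreen)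
open Literature.MathematicalPhysics.QuantumFieldTheory.BalabanImbrieJaffe1984to88.BIJ85Thm711TorusTransport (EK_shift)

/-! ## §1 Two more `τ`-letters (bi-Laplacian under the transport) -/

section ISite

variable {d : ℕ}

/-- `Δ_n²u(t) = 0 ⇒ Δ₁²u(t) = 0` (`Δ_n = n²Δ₁`, `n ≠ 0`). [cite: Balaban1984PropagatorsI, (1.21) p.21] -/
theorem LapS_LapS_one_eq_zero_of_natCast (N : Fin d → ℕ) [∀ μ, NeZero (N μ)] (n : ℕ) [NeZero n] (f : Tor N → ℂ) (t : Tor N)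
    (h : (LapS N (n : ℂ) *ᵥ (LapS N (n : ℂ) *ᵥ f)) t = 0) : (LapS N 1 *ᵥ (LapS N 1 *ᵥ f)) t = 0 := by
  have hnC : (n : ℂ) ≠ 0 := by exact_mod_cast NeZero.ne n
  have h1 : LapS N (n : ℂ) *ᵥ f = fun s => (n : ℂ) ^ 2 * (LapS N 1 *ᵥ f) s :=
    funext fun s => Prop7CentreHarmonicDivDictionary.LapS_natCast_mulVec N n f s
  rw [Prop7CentreHarmonicDivDictionary.LapS_natCast_mulVec N n, h1] at h
  have h2 : (fun s => (n : ℂ) ^ 2 * (LapS N 1 *ᵥ f) s) = ((n : ℂ) ^ 2) • (LapS N 1 *ᵥ f) := rfl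
  rw [h2, Matrix.mulVec_smul, Pi.smul_apply, smul_eq_mul] at h
  have hn2 : (n : ℂ) ^ 2 ≠ 0 := pow_ne_zero _ hnC
  rcases mul_eq_zero.1 h with h | h
  · exact absurd h hn2
  rcases mul_eq_zero.1 h with h | h
  · exact absurd h hn2
  exact h

variable {P : Params} {k : ℕ}

/-- ★ **`laplace c ∘ laplace c` UNDER `τ`**: `laplace c (laplace c (Re ∘ F ∘ τ)) z = c⁴·Re((Δ₁²F)(τ z))`. [cite: Balaban1984PropagatorsI, (1.21) p.21] -/
theorem laplace_laplace_re_comp_tau (hk : k ≤ P.m + P.K) (w : Tor (fine (P.L ^ k) (Mk P k))) (c : ℝ)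
    (F : Tor (fine (P.L ^ k) (Mk P k)) → ℂ) (z : Site P 0) :
    laplace c (laplace c (fun z' : Site P 0 => (F (EK hk z' - w)).re)) z
      = c ^ 4 * ((LapS (fine (P.L ^ k) (Mk P k)) 1 *ᵥ (LapS (fine (P.L ^ k) (Mk P k)) 1 *ᵥ F)) (EK hk z - w)).re := by
  have h1 : laplace c (fun z' : Site P 0 => (F (EK hk z' - w)).re)
      = fun z' => c ^ 2 * ((LapS (fine (P.L ^ k) (Mk P k)) 1 *ᵥ F) (EK hk z' - w)).re := by
    funext z'
    rw [laplace_eq_sq_smul_laplace_one, smul_eq_mul, laplace_one_re_comp_tau]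
  rw [h1, laplace_eq_sq_smul_laplace_one, smul_eq_mul, laplace_one_const_mul, laplace_one_re_comp_tau]
  ring

end ISite

/-! ## §2 (A0)₂ The dictionary `Δ₁⁻² = ¼·G̃₂` -/

section Dict

variable {d L : ℕ} [NeZero L]

/-- **a Fourier multiplier's matrix entry** for the constant family: `((U*·diag a·U))(x,z) = L^{−d}·Σ_p a(p)·χ_p(x − z)`. [cite: Balaban1984PropagatorsI, Sect. C p.22] -/
theorem sandwich_apply_const (a : TorusSite d L → ℂ) (x z : TorusSite d L) :
    ((dft (fun _ : Fin d => L))ᴴ * Matrix.diagonal a * dft (fun _ : Fin d => L)) x z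
      = ((((L : ℝ) ^ d)⁻¹ : ℝ) : ℂ) * ∑ p : TorusSite d L, a p * chi (fun _ : Fin d => L) p (x - z) := by
  have hcard : (Fintype.card (Tor (fun _ : Fin d => L)) : ℝ) = (L : ℝ) ^ d := by
    rw [show Fintype.card (Tor (fun _ : Fin d => L)) = Fintype.card (Fin d → ZMod L) from rfl, Fintype.card_fun, ZMod.card, Fintype.card_fin]
    push_cast; ring
  have hcT : ((cT (fun _ : Fin d => L) : ℂ)) * (cT (fun _ : Fin d => L) : ℂ) = ((((L : ℝ) ^ d)⁻¹ : ℝ) : ℂ) := by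
    rw [← Complex.ofReal_mul]
    congr 1
    unfold cT
    rw [hcard, ← mul_inv, Real.mul_self_sqrt (by positivity)]
  rw [Matrix.mul_apply]
  simp only [Matrix.mul_diagonal, Matrix.conjTranspose_apply, Complex.star_def, conj_dft]
  rw [Finset.mul_sum]
  refine Finset.sum_congr rfl fun p _ => ?_
  rw [dft_apply', sub_eq_add_neg, chi_add_right]
  have hneg : chi (fun _ : Fin d => L) p (-z) = conj (chi (fun _ : Fin d => L) p z) := by
    rw [conj_chi]
    unfold chi
    refine Finset.prod_congr rfl fun μ _ => ?_
    congr 1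
    simp only [Pi.neg_apply]; ring
  rw [hneg, ← hcT]
  ring

/-- `(Δ₁⁻¹·Δ₁⁻¹)(x,z) = L^{−d}·Σ_p linv(p)²·χ_p(x − z)`. [cite: Balaban1984PropagatorsI, Sect. C p.22] -/
theorem LapSinv_one_sq_apply (x z : TorusSite d L) :
    (LapSinv (fun _ : Fin d => L) (1 : ℂ) * LapSinv (fun _ : Fin d => L) (1 : ℂ)) x z
      = ((((L : ℝ) ^ d)⁻¹ : ℝ) : ℂ) * ∑ p : TorusSite d L,
          (linv (fun _ : Fin d => L) (1 : ℂ) p * linv (fun _ : Fin d => L) (1 : ℂ) p) * chi (fun _ : Fin d => L) p (x - z) := by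
  unfold LapSinv
  rw [sandwich_mul]
  exact sandwich_apply_const _ x z

/-- ★★ **THE DICTIONARY `Δ₁⁻² = ¼·G̃₂`**: `(LapSinv (fun _ ↦ L) 1 * LapSinv (fun _ ↦ L) 1) x z = ¼·(Σ_{k≠0} cos(p_k·(x−z))∕ε(p_k)²)∕L^d` (real) — B5's squared zero-mode-free inverse
Laplacian at unit lattice factor is a quarter of the biharmonic torus Green function `G̃₂` in the displayed currency of ✓ `Prop7TorusGreen2HeatKernel` (`linv 1 p = (2ε_p)⁻¹`).
[cite: Balaban1984PropagatorsI, Sect. C p.22; Balaban1985RegularSpaces, (1.14) p.78] -/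
theorem LapSinv_one_sq_apply_eq_quarter_green2 (x z : TorusSite d L) :
    (LapSinv (fun _ : Fin d => L) (1 : ℂ) * LapSinv (fun _ : Fin d => L) (1 : ℂ)) x z
      = (((∑ k ∈ (univ : Finset (TorusSite d L)).erase 0,
            Real.cos (∑ i, latticeMomentum L k i * (((x - z) i).val : ℝ)) / dispersion (latticeMomentum L k) ^ 2) / (L : ℝ) ^ d / 4 : ℝ) : ℂ) := by
  set S : ℂ := ∑ p : TorusSite d L,
      (linv (fun _ : Fin d => L) (1 : ℂ) p * linv (fun _ : Fin d => L) (1 : ℂ) p) * chi (fun _ : Fin d => L) p (x - z) with hS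
  have hterm : ∀ p : TorusSite d L,
      ((linv (fun _ : Fin d => L) (1 : ℂ) p * linv (fun _ : Fin d => L) (1 : ℂ) p) * chi (fun _ : Fin d => L) p (x - z)).re
        = if p = 0 then 0 else Real.cos (∑ i, latticeMomentum L p i * (((x - z) i).val : ℝ)) / dispersion (latticeMomentum L p) ^ 2 / 4 := by
    intro p
    rw [linv_one_eq]
    split_ifs with hp
    · simp
    · rw [← Complex.ofReal_mul, Complex.re_ofReal_mul, chi_const_eq_torusChar, torusChar_re]
      have hε := dispersion_latticeMomentum_pos hp
      field_simp
      ring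
  have hre : S.re = (∑ k ∈ (univ : Finset (TorusSite d L)).erase 0,
      Real.cos (∑ i, latticeMomentum L k i * (((x - z) i).val : ℝ)) / dispersion (latticeMomentum L k) ^ 2) / 4 := by
    rw [hS, Complex.re_sum, Finset.sum_congr rfl fun p _ => hterm p, Finset.sum_ite, Finset.sum_const_zero, zero_add,
      Finset.filter_ne', ← Finset.sum_div]
  have hconj : conj S = S := by
    rw [hS, map_sum]
    rw [← Equiv.sum_comp (Equiv.neg (TorusSite d L))
      (fun p => (linv (fun _ : Fin d => L) (1 : ℂ) p * linv (fun _ : Fin d => L) (1 : ℂ) p) * chi (fun _ : Fin d => L) p (x - z))]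
    refine Finset.sum_congr rfl fun p _ => ?_
    simp only [Equiv.neg_apply, map_mul]
    rw [chi_neg_left', linv_one_eq, linv_one_eq]
    by_cases hp : p = 0
    · subst hp; simp
    · have hnp : -p ≠ 0 := fun h => hp (neg_eq_zero.mp h)
      rw [if_neg hp, if_neg hnp, dispersion_latticeMomentum_neg, Complex.conj_ofReal]
  have him : S.im = 0 := by
    have := congrArg Complex.im hconj
    rw [Complex.conj_im] at this
    linarith
  rw [LapSinv_one_sq_apply, ← hS]
  apply Complex.ext
  · rw [Complex.re_ofReal_mul, hre, Complex.ofReal_re]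
    field_simp
  · rw [Complex.mul_im, Complex.ofReal_re, Complex.ofReal_im, him, Complex.ofReal_im]
    ring

end Dict


/-! ## §3 (R5c-formula) The structured Green kernel on `Site P 0` with the free part written as a `G̃₂` difference -/

section SiteSide

variable {P : Params} {k : ℕ}

/-- ★★★ **THE PINNED BIHARMONIC GREEN KERNEL ON `Site P 0`, WITH ITS SPLIT AND THE FREE KERNEL IN `G̃₂` LETTERS** — ✓ `Prop7GreenKernelSiteTransport.exists_green_site_split` VERBATIM
(same construction) plus ONE conjunct: for every `G₂` displayed as the biharmonic torus Green function of period `L_T = L^k·sitesPerDir k` (the `hG` currency of ✓ `Prop7TorusGreen2HessianDecay`),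
`Gf x z = (4c⁴)⁻¹·(G₂(EK z − EK x) − G₂(EK z − EK y_c))` — so (R2) `|∇G̃₂| ≤ C_V` and (R3a) `|∇∇G̃₂|·dist ≤ C_H` read directly on `V := Gf b₊ − Gf b₋` (§4).
[cite: Balaban1984PropagatorsI, Sect. C p.22, (1.17)–(1.21) pp.20–21; Balaban1985RegularSpaces, (1.14) p.78] -/
theorem exists_green_site_split_free (hk : k ≤ P.m + P.K) {c : ℝ} (hc : c ≠ 0)
    {V : Type*} [NormedAddCommGroup V] [NormedSpace ℝ V] :
    ∃ Gf Uf G : Site P 0 → Site P 0 → ℝ,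
      (∀ x z, G x z = Gf x z - Uf x z)
      ∧ (∀ x (y : Site P k), Uf x (embIter k y) = Gf x (embIter k y))
      ∧ (∀ x, ∀ y ∈ Set.range (embIter k), G x y = 0)
      ∧ (∀ x z, z ∉ Set.range (embIter k) → laplace c (laplace c (Uf x)) z = 0)
      ∧ (∀ x z, laplace c (Gf x) z = (2 * c ^ 2)⁻¹ *
          (torusGreen (L := P.L ^ k * P.sitesPerDir k) (EK hk z - EK hk x)
            - torusGreen (L := P.L ^ k * P.sitesPerDir k) (EK hk z - EK hk (embIter k default))))
      ∧ (∀ x z, laplace c (laplace c (Gf x)) z = (if z = x then (1 : ℝ) else 0) - (if z = embIter k default then (1 : ℝ) else 0))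
      ∧ (∀ G₂ : TorusSite P.d (P.L ^ k * P.sitesPerDir k) → ℝ,
          (∀ t : TorusSite P.d (P.L ^ k * P.sitesPerDir k),
            G₂ t = (∑ q ∈ (univ : Finset (TorusSite P.d (P.L ^ k * P.sitesPerDir k))).erase 0,
              Real.cos (∑ i, latticeMomentum (P.L ^ k * P.sitesPerDir k) q i * ((t i).val : ℝ))
                / dispersion (latticeMomentum (P.L ^ k * P.sitesPerDir k) q) ^ 2)
              / (((P.L ^ k * P.sitesPerDir k : ℕ) : ℝ)) ^ P.d) →
          ∀ x z, Gf x z = (4 * c ^ 4)⁻¹ * (G₂ (EK hk z - EK hk x) - G₂ (EK hk z - EK hk (embIter k default))))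
      ∧ ∀ e : SiteField P 0 V, (∀ y ∈ Set.range (embIter k), e y = 0) →
          ∀ x, e x = ∑ z, G x z • laplace c (laplace c e) z := by
  classical
  haveI : NeZero (P.L ^ k) := ⟨pow_ne_zero _ P.L_pos.ne'⟩
  haveI hNZ : NeZero (P.L ^ k * P.sitesPerDir k) := ⟨mul_ne_zero (pow_ne_zero _ P.L_pos.ne') (P.sitesPerDir_ne_zero k)⟩
  have hn : 1 ≤ P.L ^ k := Nat.one_le_pow _ _ P.L_pos
  set n : ℕ := P.L ^ k with hn'
  set M : Fin P.d → ℕ := Mk P k with hM'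
  obtain ⟨w, hw⟩ := exists_translate hk
  set y₀ : Site P k := default with hy₀
  obtain ⟨GfT, UT, GT, hGfT, hGT, hU1, hU2, hL1, hL2, hG0, hrep⟩ :=
    exists_pinned_biharmonic_green_split (P.L ^ k) (Mk P k) hn y₀
  have hc2 : c ^ 2 ≠ 0 := pow_ne_zero _ hc
  have hc4 : c ^ 4 ≠ 0 := pow_ne_zero _ hc
  -- the transported kernels
  set Gf : Site P 0 → Site P 0 → ℝ := fun x z => (c ^ 4)⁻¹ * (GfT (EK hk x - w) (EK hk z - w)).re with hGf
  set Uf : Site P 0 → Site P 0 → ℝ := fun x z => (c ^ 4)⁻¹ * (UT (EK hk x - w) (EK hk z - w)).re with hUf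
  set G : Site P 0 → Site P 0 → ℝ := fun x z => (c ^ 4)⁻¹ * (GT (EK hk x - w) (EK hk z - w)).re with hG
  -- `laplace c ∘ laplace c` of a transported kernel
  have hLL : ∀ (F : Tor (fine (P.L ^ k) (Mk P k)) → Tor (fine (P.L ^ k) (Mk P k)) → ℂ) (x z : Site P 0),
      laplace c (laplace c (fun z' : Site P 0 => (c ^ 4)⁻¹ * (F (EK hk x - w) (EK hk z' - w)).re)) z
        = ((LapS (fine (P.L ^ k) (Mk P k)) 1 *ᵥ (LapS (fine (P.L ^ k) (Mk P k)) 1 *ᵥ F (EK hk x - w))) (EK hk z - w)).re := by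
    intro F x z
    have h1 : laplace 1 (fun z' : Site P 0 => (c ^ 4)⁻¹ * (F (EK hk x - w) (EK hk z' - w)).re)
        = fun z' => (c ^ 4)⁻¹ * ((LapS (fine (P.L ^ k) (Mk P k)) 1 *ᵥ F (EK hk x - w)) (EK hk z' - w)).re := by
      funext z'
      rw [laplace_one_const_mul, laplace_one_re_comp_tau]
    have h2 : laplace c (fun z' : Site P 0 => (c ^ 4)⁻¹ * (F (EK hk x - w) (EK hk z' - w)).re)
        = fun z' => c ^ 2 * ((c ^ 4)⁻¹ * ((LapS (fine (P.L ^ k) (Mk P k)) 1 *ᵥ F (EK hk x - w)) (EK hk z' - w)).re) := by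
      funext z'
      rw [laplace_eq_sq_smul_laplace_one, h1, smul_eq_mul]
    rw [h2, laplace_eq_sq_smul_laplace_one, smul_eq_mul, laplace_one_const_mul, laplace_one_const_mul, laplace_one_re_comp_tau]
    field_simp
  -- `laplace c` of a transported kernel
  have hL : ∀ (F : Tor (fine (P.L ^ k) (Mk P k)) → Tor (fine (P.L ^ k) (Mk P k)) → ℂ) (x z : Site P 0),
      laplace c (fun z' : Site P 0 => (c ^ 4)⁻¹ * (F (EK hk x - w) (EK hk z' - w)).re) z
        = (c ^ 2)⁻¹ * ((LapS (fine (P.L ^ k) (Mk P k)) 1 *ᵥ F (EK hk x - w)) (EK hk z - w)).re := by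
    intro F x z
    rw [laplace_eq_sq_smul_laplace_one, smul_eq_mul, laplace_one_const_mul, laplace_one_re_comp_tau]
    field_simp
  refine ⟨Gf, Uf, G, ?_, ?_, ?_, ?_, ?_, ?_, ?_, ?_⟩
  · -- the split
    intro x z
    simp only [hGf, hUf, hG, hGT, Complex.sub_re, mul_sub]
  · -- the interpolant agrees with the free part at the centres
    intro x y
    simp only [hGf, hUf, tau_embIter hk w hw, hU1]
  · -- `G` vanishes at the centres
    rintro x _ ⟨y, rfl⟩
    simp only [hG, tau_embIter hk w hw, hG0, Complex.zero_re, mul_zero]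
  · -- the interpolant is biharmonic off the centres
    intro x z hz
    rw [hUf, hLL UT x z, hU2 _ _ (tau_ne_up_of_not_mem hk w hw hz), Complex.zero_re]
  · -- the free Laplacian is the Green's function difference
    intro x z
    rw [hGf, hL GfT x z, hL1, LapSinv_one_apply_eq_half_torusGreen (d := P.d) (L := P.L ^ k * P.sitesPerDir k),
      ← tau_embIter hk w hw y₀, LapSinv_one_apply_eq_half_torusGreen (d := P.d) (L := P.L ^ k * P.sitesPerDir k),
      sub_sub_sub_cancel_right, sub_sub_sub_cancel_right, ← Complex.ofReal_sub, Complex.ofReal_re]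
    ring
  · -- the free bi-Laplacian is the dipole of deltas
    intro x z
    rw [hGf, hLL GfT x z, hL2, ← tau_embIter hk w hw y₀]
    simp only [tau_eq_tau_iff, Complex.sub_re, apply_ite Complex.re, Complex.one_re, Complex.zero_re]
  · -- the free kernel itself is a `G̃₂` difference (dictionary `Δ₁⁻² = ¼·G̃₂`)
    intro G₂ hG₂ x z
    have hGfx : GfT (EK hk x - w) = (LapSinv (fine (P.L ^ k) (Mk P k)) 1 * LapSinv (fine (P.L ^ k) (Mk P k)) 1) *ᵥ
        (fun z' => (if z' = EK hk x - w then (1 : ℂ) else 0) - (if z' = up (P.L ^ k) (Mk P k) y₀ then (1 : ℂ) else 0)) := by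
      rw [hGfT, Matrix.mulVec_mulVec]
    have hq1 := LapSinv_one_sq_apply_eq_quarter_green2 (d := P.d) (L := P.L ^ k * P.sitesPerDir k) (EK hk z - w) (EK hk x - w)
    have hq2 := LapSinv_one_sq_apply_eq_quarter_green2 (d := P.d) (L := P.L ^ k * P.sitesPerDir k) (EK hk z - w)
      (up (P.L ^ k) (Mk P k) y₀)
    rw [hGf]
    beta_reduce
    rw [hGfx, mulVec_deltaSub, hq1, hq2, ← tau_embIter hk w hw y₀, sub_sub_sub_cancel_right, sub_sub_sub_cancel_right,
      ← Complex.ofReal_sub, Complex.ofReal_re, hG₂, hG₂]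
    field_simp
  · -- the representation: scalar case by `Re`, then Hahn–Banach
    have hscalar : ∀ e : SiteField P 0 ℝ, (∀ y ∈ Set.range (embIter k), e y = 0) →
        ∀ x, e x = ∑ z, G x z * laplace c (laplace c e) z := by
      intro e he x
      set eT : Tor (fine (P.L ^ k) (Mk P k)) → ℂ := fun s => ((e ((EK hk).symm (s + w)) : ℝ) : ℂ) with heT
      have heT0 : ∀ y, eT (up (P.L ^ k) (Mk P k) y) = 0 := fun y => by
        simp only [heT, EK_symm_up_add hk w hw, he _ ⟨y, rfl⟩, Complex.ofReal_zero]
      have h := hrep eT heT0 (EK hk x - w)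
      have hx : eT (EK hk x - w) = ((e x : ℝ) : ℂ) := by simp only [heT, EK_symm_tau_add]
      have hΔ : LapS (fine (P.L ^ k) (Mk P k)) 1 *ᵥ (LapS (fine (P.L ^ k) (Mk P k)) 1 *ᵥ eT)
          = fun t => ((laplace 1 (laplace 1 e) ((EK hk).symm (t + w)) : ℝ) : ℂ) := by
        rw [heT, LapS_one_ofReal_comp_tauInv, LapS_one_ofReal_comp_tauInv]
      rw [hx, hΔ, ← sum_comp_tau hk w] at h
      simp only [EK_symm_tau_add] at h
      have h' := congrArg Complex.re h
      rw [Complex.ofReal_re, Complex.re_sum] at h'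
      rw [h']
      have hcc : ∀ z, laplace c (laplace c e) z = c ^ 4 * laplace 1 (laplace 1 e) z := by
        intro z
        have e1 : laplace c e = fun x => c ^ 2 * laplace 1 e x := funext fun x => by
          rw [laplace_eq_sq_smul_laplace_one, smul_eq_mul]
        rw [laplace_eq_sq_smul_laplace_one, smul_eq_mul, e1, laplace_one_const_mul]
        ring
      refine Finset.sum_congr rfl fun z _ => ?_
      rw [Complex.re_mul_ofReal, hcc z, hG]
      beta_reduce
      field_simp
    intro e he x
    refine (SeparatingDual.eq_iff_forall_dual_eq (R := ℝ)).2 fun g => ?_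
    have hg := hscalar (fun x => g (e x)) (fun y hy => by simp only [he y hy, map_zero]) x
    rw [hg]
    simp only [map_sum, map_smul, smul_eq_mul]
    refine Finset.sum_congr rfl fun z _ => ?_
    have e1 : laplace c (fun x => g (e x)) = fun x => g (laplace c e x) := funext fun x => laplace_comp_clm g c e x
    rw [e1, laplace_comp_clm]


end SiteSide

end Summit.QuantumFields.YangMills.Theorems.Prop7GreenKernelSiteFree
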